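import Summits.ValiantsHypothesis.ValiantsHypothesis.Theorems.LacunarySymmetroidMatrixDescartesCensusNewtonCone
import Summits.ValiantsHypothesis.ValiantsHypothesis.Theorems.LacunarySymmetroidMatrixDescartesCensusFullAlternation

/-!
# `MatrixDescartes` census — kit for UNIFORM-in-`N` T-NC certificates (indexed fewnomials, far-factor monotonicity)

HONEST FRAMING.  Object-search cell `pub-symmetroid`, crux `Theses.LacunarySymmetroid.MatrixDescartes`
(stmt-ValiantsHypothesis-18050).  Elementary lemmas used by the kernel version of the cell's uniform-in-`N` support
certificate (T-NC-LP-CERT §11, «`ζ(2,6; B ∪ {N}) ≤ 19` for all `N ≥ N₁`»), where the top exponent `N` is SYMBOLIC and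
nothing can be `decide`d:

* INDEXED FEWNOMIALS `f = ∑ t, C (c t) * X ^ (e t)` with `e : Fin n → ℕ` strictly increasing: coefficient extraction,
  support, and the two consequences of Descartes-sharpness (`n ≤ #Z₊(f) + 1`) in indexed form — every coefficient is
  non-zero (`indexed_ne_zero_of_sharp`) and adjacent coefficients alternate (`indexed_alternate_of_sharp`, from F1
  `coeff_mul_coeff_neg_of_sharp`); sign chains relative to `c 0` (`mul_pos_of_mul_neg_of_mul_neg`, …);
* GAP PRODUCTS: `∏_{u ≠ s} |e s − e u|` split into the parts below and above `s` with honest real subtraction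
  (`prod_erase_abs_sub_eq`), so that symbolic exponents need no truncated subtraction;
* FAR-FACTOR MONOTONICITY (the one inequality behind uniformity): for `p < q < r < u₀ ≤ u` with gaps `a = q − p`,
  `b = r − q`, the Newton-cone weight ratio `(u−q)^(a+b) / ((u−p)^b (u−r)^a)` is NON-INCREASING in `u`
  (`far_factor_le`: two-point Jensen for the convex `y ↦ log (1 + x/y)`, proved through the weighted GM–HM inequality),
  and the bookkeeping lemma `row_transfer` that trades the symbolic weights of a Newton row for the weights at `N₁`.

Nothing here is specific to one support; nothing bears on the crux or on `VP ≠ VNP`.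

[folklore] Elementary real analysis / bookkeeping.
-/

-- `Summit.ValiantsHypothesis.ValiantsHypothesis.…` repeats a component by the D-0017 layout
-- (single-conjunct summit), which the `dupNamespace` linter flags; the name is mandated.
set_option linter.dupNamespace false

namespace Summit.ValiantsHypothesis.ValiantsHypothesis.Theorems.LacunarySymmetroidMatrixDescartes.Census

open Polynomial Finset
open scoped BigOperators Polynomial

/-! ## Indexed fewnomials -/

/-- Coefficient of an indexed fewnomial at one of its (injective) exponents. [folklore] -/
theorem coeff_sum_C_mul_X_pow_self {n : ℕ} (e : Fin n → ℕ) (he : Function.Injective e) (c : Fin n → ℝ) (s : Fin n) :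
    (∑ t, C (c t) * X ^ (e t)).coeff (e s) = c s := by
  rw [finsetSum_coeff]
  simp_rw [coeff_C_mul_X_pow]
  rw [Finset.sum_eq_single s]
  · simp
  · intro t _ hts
    rw [if_neg (fun h => hts (he h).symm)]
  · intro h; exact absurd (Finset.mem_univ s) h

/-- Coefficient of an indexed fewnomial away from its exponents. [folklore] -/
theorem coeff_sum_C_mul_X_pow_of_ne {n : ℕ} (e : Fin n → ℕ) (c : Fin n → ℝ) {k : ℕ} (hk : ∀ t, e t ≠ k) :
    (∑ t, C (c t) * X ^ (e t)).coeff k = 0 := by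
  rw [finsetSum_coeff]
  simp_rw [coeff_C_mul_X_pow]
  exact Finset.sum_eq_zero fun t _ => if_neg fun h => hk t h.symm

/-- The support of an indexed fewnomial lies in the image of its exponent map. [folklore] -/
theorem support_sum_C_mul_X_pow_subset {n : ℕ} (e : Fin n → ℕ) (c : Fin n → ℝ) :
    (∑ t, C (c t) * X ^ (e t)).support ⊆ Finset.univ.image e := by
  intro k hk
  rw [mem_support_iff] at hk
  by_contra hne
  refine hk (coeff_sum_C_mul_X_pow_of_ne e c fun t ht => hne ?_)
  exact Finset.mem_image.2 ⟨t, Finset.mem_univ _, ht⟩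

/-- With all coefficients non-zero the support IS the image of the exponent map. [folklore] -/
theorem support_sum_C_mul_X_pow_eq {n : ℕ} (e : Fin n → ℕ) (he : Function.Injective e) (c : Fin n → ℝ)
    (hc : ∀ t, c t ≠ 0) : (∑ t, C (c t) * X ^ (e t)).support = Finset.univ.image e := by
  refine Finset.Subset.antisymm (support_sum_C_mul_X_pow_subset e c) ?_
  intro k hk
  obtain ⟨t, -, rfl⟩ := Finset.mem_image.1 hk
  rw [mem_support_iff, coeff_sum_C_mul_X_pow_self e he c t]
  exact hc t

/-- **Sharpness ⇒ full support, indexed form.**  If `∑_{t<n} c_t X^{e_t}` (`e` strictly increasing) is non-zero and has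
at least `n − 1` distinct positive roots, then no `c_t` vanishes (sparse Descartes: `#Z₊ < #supp`). [folklore] -/
theorem indexed_ne_zero_of_sharp {n : ℕ} (e : Fin n → ℕ) (he : StrictMono e) (c : Fin n → ℝ)
    (hf : (∑ t, C (c t) * X ^ (e t)) ≠ 0)
    (hZ : n ≤ ((∑ t, C (c t) * X ^ (e t)).roots.toFinset.filter (fun x => 0 < x)).card + 1) :
    ∀ t, c t ≠ 0 := by
  intro t₀ h0
  have hsub : (∑ t, C (c t) * X ^ (e t)).support ⊆ (Finset.univ.erase t₀).image e := by
    intro k hk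
    rw [mem_support_iff] at hk
    by_contra hne
    refine hk (coeff_sum_C_mul_X_pow_of_ne e c fun t ht => ?_)
    rcases eq_or_ne t t₀ with rfl | htt
    · rw [← ht, coeff_sum_C_mul_X_pow_self e he.injective c t] at hk
      exact hk h0
    · exact hne (Finset.mem_image.2 ⟨t, Finset.mem_erase.2 ⟨htt, Finset.mem_univ _⟩, ht⟩)
  have h1 := Literature.Computability.AlgebraicComplexity.card_roots_toFinset_filter_pos_lt_card_support hf
  have h2 : (∑ t, C (c t) * X ^ (e t)).support.card ≤ n - 1 :=
    (Finset.card_le_card hsub).trans (Finset.card_image_le.trans (by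
      rw [Finset.card_erase_of_mem (Finset.mem_univ _), Finset.card_univ, Fintype.card_fin]))
  omega

/-- **F1, indexed form.**  Under the same sharpness, ADJACENT coefficients have opposite signs. [folklore] -/
theorem indexed_alternate_of_sharp {n : ℕ} (e : Fin (n + 1) → ℕ) (he : StrictMono e) (c : Fin (n + 1) → ℝ)
    (hc : ∀ t, c t ≠ 0)
    (hZ : n + 1 ≤ ((∑ t, C (c t) * X ^ (e t)).roots.toFinset.filter (fun x => 0 < x)).card + 1)
    (t : Fin n) : c t.castSucc * c t.succ < 0 := by
  have hsupp := support_sum_C_mul_X_pow_eq e he.injective c hc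
  have hcard : (∑ t, C (c t) * X ^ (e t)).support.card = n + 1 := by
    rw [hsupp, Finset.card_image_of_injective _ he.injective, Finset.card_univ, Fintype.card_fin]
  have hZ' : (∑ t, C (c t) * X ^ (e t)).support.card
      ≤ ((∑ t, C (c t) * X ^ (e t)).roots.toFinset.filter (fun x => 0 < x)).card + 1 := by
    rw [hcard]; exact hZ
  have ha : e t.castSucc ∈ (∑ t, C (c t) * X ^ (e t)).support := by
    rw [hsupp]; exact Finset.mem_image_of_mem _ (Finset.mem_univ _)
  have hb : e t.succ ∈ (∑ t, C (c t) * X ^ (e t)).support := by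
    rw [hsupp]; exact Finset.mem_image_of_mem _ (Finset.mem_univ _)
  have hab : e t.castSucc < e t.succ := he Fin.castSucc_lt_succ
  have hcons : ∀ k ∈ (∑ t, C (c t) * X ^ (e t)).support, ¬ (e t.castSucc < k ∧ k < e t.succ) := by
    intro k hk hlt
    rw [hsupp, Finset.mem_image] at hk
    obtain ⟨u, -, rfl⟩ := hk
    have h1 : t.castSucc < u := he.lt_iff_lt.1 hlt.1
    have h2 : u < t.succ := he.lt_iff_lt.1 hlt.2
    rw [Fin.lt_def] at h1 h2
    simp only [Fin.val_castSucc, Fin.val_succ] at h1 h2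
    omega
  have key := coeff_mul_coeff_neg_of_sharp _ hZ' ha hb hab hcons
  rwa [coeff_sum_C_mul_X_pow_self e he.injective c, coeff_sum_C_mul_X_pow_self e he.injective c] at key

/-- Sign chain: `a·b < 0` and `b·c < 0` give `a·c > 0`. [folklore] -/
theorem mul_pos_of_mul_neg_of_mul_neg {a b c : ℝ} (h1 : a * b < 0) (h2 : b * c < 0) : 0 < a * c := by
  have hb : b ≠ 0 := by rintro rfl; simp at h1
  have hb2 : 0 < b * b := mul_self_pos.2 hb
  have h : 0 < (a * c) * (b * b) := by nlinarith [mul_pos_of_neg_of_neg h1 h2]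
  exact (pos_iff_pos_of_mul_pos h).2 hb2

/-- Sign chain: `a·b > 0` and `b·c < 0` give `a·c < 0`. [folklore] -/
theorem mul_neg_of_mul_pos_of_mul_neg {a b c : ℝ} (h1 : 0 < a * b) (h2 : b * c < 0) : a * c < 0 := by
  have hb : b ≠ 0 := by rintro rfl; simp at h1
  have hb2 : 0 < b * b := mul_self_pos.2 hb
  have h : (a * c) * (b * b) < 0 := by nlinarith [mul_neg_of_pos_of_neg h1 h2]
  exact neg_of_mul_neg_left h hb2.le

/-! ## Gap products with symbolic exponents -/

/-- An erased product equals the full product with the erased factor replaced by `1`. [folklore] -/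
theorem prod_erase_eq_prod_ite {n : ℕ} (s : Fin n) (g : Fin n → ℝ) :
    ∏ u ∈ Finset.univ.erase s, g u = ∏ u, (if u = s then 1 else g u) := by
  rw [← Finset.prod_erase (Finset.univ) (f := fun u => if u = s then (1 : ℝ) else g u) (a := s) (by simp)]
  exact Finset.prod_congr rfl fun u hu => by rw [if_neg (Finset.ne_of_mem_erase hu)]

/-- **Gap product split.**  For strictly increasing `e`, `∏_{u ≠ s} |e s − e u|` is the product of the honest
differences `e s − e u` over `u < s` times `e u − e s` over `u > s` (real subtraction). [folklore] -/
theorem prod_erase_abs_sub_eq {n : ℕ} (e : Fin n → ℕ) (he : StrictMono e) (s : Fin n) :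
    ∏ u ∈ Finset.univ.erase s, |((e s : ℕ) : ℝ) - ((e u : ℕ) : ℝ)|
      = ∏ u, (if u < s then ((e s : ℕ) : ℝ) - ((e u : ℕ) : ℝ) else
              if s < u then ((e u : ℕ) : ℝ) - ((e s : ℕ) : ℝ) else 1) := by
  rw [prod_erase_eq_prod_ite]
  refine Finset.prod_congr rfl fun u _ => ?_
  rcases lt_trichotomy u s with h | rfl | h
  · rw [if_neg h.ne, if_pos h, abs_of_nonneg]
    have := he h
    exact sub_nonneg.2 (by exact_mod_cast this.le)
  · simp
  · rw [if_neg h.ne', if_neg (not_lt.2 h.le), if_pos h, abs_of_nonpos, neg_sub]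
    have := he h
    exact sub_nonpos.2 (by exact_mod_cast this.le)

/-! ## Far-factor monotonicity -/

/-- Two-point Jensen for the convex function `y ↦ log (1 + x / y)` in product form (`x ≥ 0`, `γ > 0`, weights
`b/(a+b)` and `a/(a+b)` at the points `γ + b + a` and `γ`, whose weighted mean is `γ + b`):
`(1 + x/(γ+b))^(a+b) ≤ (1 + x/(γ+b+a))^b · (1 + x/γ)^a`, cleared of denominators.  Proof: weighted GM ≥ HM for the two
numbers `1 + x/(γ+b+a)`, `1 + x/γ`, and concavity of `y ↦ y/(y+x)`. [folklore] -/
theorem far_factor_le (x γ : ℝ) (hx : 0 ≤ x) (hγ : 0 < γ) (a b : ℕ) :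
    (x + (γ + b)) ^ (a + b) * (γ + b + a) ^ b * γ ^ a ≤ (γ + b) ^ (a + b) * (x + (γ + b + a)) ^ b * (x + γ) ^ a := by
  rcases Nat.eq_zero_or_pos (a + b) with hab | hab
  · have ha : a = 0 := by omega
    have hb : b = 0 := by omega
    subst ha; subst hb; simp
  -- the two points `y₁ = γ + b + a`, `y₂ = γ`, their weights, and the weighted mean `ȳ = γ + b`
  have hy₁ : (0 : ℝ) < γ + b + a := by positivity
  have hyb : (0 : ℝ) < γ + b := by positivity
  have habR : (0 : ℝ) < (a : ℝ) + b := by exact_mod_cast (show 0 < a + b from hab)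
  set w₁ : ℝ := (b : ℝ) / (a + b) with hw₁def
  set w₂ : ℝ := (a : ℝ) / (a + b) with hw₂def
  have hw₁ : 0 ≤ w₁ := by positivity
  have hw₂ : 0 ≤ w₂ := by positivity
  have hw : w₁ + w₂ = 1 := by
    rw [hw₁def, hw₂def, ← add_div, div_eq_one_iff_eq habR.ne']; ring
  -- `zᵢ = (x + yᵢ)/yᵢ`; AM–GM on the inverses `yᵢ/(x + yᵢ)`
  have hz₁ : (0 : ℝ) < (x + (γ + b + a)) / (γ + b + a) := by positivity
  have hz₂ : (0 : ℝ) < (x + γ) / γ := by positivity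
  have amgm := Real.geom_mean_le_arith_mean2_weighted hw₁ hw₂ (inv_nonneg.2 hz₁.le) (inv_nonneg.2 hz₂.le) hw
  -- AM–HM (convexity of `y ↦ x/(x+y)`): the weighted mean of `yᵢ/(x+yᵢ)` is at most `ȳ/(x+ȳ)`
  have amhm : w₁ * ((x + (γ + b + a)) / (γ + b + a))⁻¹ + w₂ * ((x + γ) / γ)⁻¹ ≤ ((x + (γ + b)) / (γ + b))⁻¹ := by
    rw [inv_div, inv_div, inv_div, hw₁def, hw₂def]
    rw [div_mul_div_comm, div_mul_div_comm, div_add_div _ _ (by positivity) (by positivity),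
      div_le_div_iff₀ (by positivity) (by positivity)]
    -- RHS − LHS = a·b·x·(a+b)² ≥ 0
    nlinarith [mul_nonneg (mul_nonneg (mul_nonneg (Nat.cast_nonneg (α := ℝ) a) (Nat.cast_nonneg (α := ℝ) b)) hx)
      (sq_nonneg ((a : ℝ) + b))]
  have h1 : (((x + (γ + b + a)) / (γ + b + a)) ^ w₁ * ((x + γ) / γ) ^ w₂)⁻¹ ≤ ((x + (γ + b)) / (γ + b))⁻¹ := by
    rw [mul_inv, ← Real.inv_rpow hz₁.le, ← Real.inv_rpow hz₂.le]
    exact amgm.trans amhm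
  have hprodpos : 0 < ((x + (γ + b + a)) / (γ + b + a)) ^ w₁ * ((x + γ) / γ) ^ w₂ := by positivity
  have h2 : (x + (γ + b)) / (γ + b) ≤ ((x + (γ + b + a)) / (γ + b + a)) ^ w₁ * ((x + γ) / γ) ^ w₂ :=
    (inv_le_inv₀ hprodpos (by positivity)).1 h1
  -- raise to the power `a + b` and convert the real exponents `wᵢ (a + b)` to `b`, `a`
  have h3 := pow_le_pow_left₀ (by positivity) h2 (a + b)
  have e1 : (((x + (γ + b + a)) / (γ + b + a)) ^ w₁) ^ (a + b) = ((x + (γ + b + a)) / (γ + b + a)) ^ b := by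
    rw [← Real.rpow_natCast, ← Real.rpow_mul hz₁.le, show w₁ * ((a + b : ℕ) : ℝ) = (b : ℝ) by
      rw [hw₁def]; push_cast; field_simp, Real.rpow_natCast]
  have e2 : (((x + γ) / γ) ^ w₂) ^ (a + b) = ((x + γ) / γ) ^ a := by
    rw [← Real.rpow_natCast, ← Real.rpow_mul hz₂.le, show w₂ * ((a + b : ℕ) : ℝ) = (a : ℝ) by
      rw [hw₂def]; push_cast; field_simp, Real.rpow_natCast]
  rw [mul_pow, e1, e2, div_pow, div_pow, div_pow, div_mul_div_comm,
    div_le_div_iff₀ (by positivity) (by positivity)] at h3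
  calc (x + (γ + b)) ^ (a + b) * (γ + b + a) ^ b * γ ^ a
      = (x + (γ + b)) ^ (a + b) * ((γ + b + a) ^ b * γ ^ a) := by ring
    _ ≤ (x + (γ + b + a)) ^ b * (x + γ) ^ a * (γ + b) ^ (a + b) := h3
    _ = (γ + b) ^ (a + b) * (x + (γ + b + a)) ^ b * (x + γ) ^ a := by ring

/-- **Row transfer.**  A Newton-cone row with symbolic far weights `Fp, Fq, Fr` implies the same row with the weights
`Gp, Gq, Gr` at the base point, given the far-factor inequality `Fq^(a+b) Gp^b Gr^a ≤ Gq^(a+b) Fp^b Fr^a`. [folklore] -/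
theorem row_transfer {A B Cc WLp WLq WLr Fp Fq Fr Gp Gq Gr : ℝ} {a b : ℕ}
    (hB : 0 ≤ B) (hWLq : 0 ≤ WLq) (hFp : 0 < Fp) (hFr : 0 < Fr) (hGp : 0 ≤ Gp) (hGr : 0 ≤ Gr)
    (hrow : (A * (WLp * Fp)) ^ b * (Cc * (WLr * Fr)) ^ a ≤ (B * (WLq * Fq)) ^ (a + b))
    (hmono : Fq ^ (a + b) * Gp ^ b * Gr ^ a ≤ Gq ^ (a + b) * Fp ^ b * Fr ^ a) :
    (A * (WLp * Gp)) ^ b * (Cc * (WLr * Gr)) ^ a ≤ (B * (WLq * Gq)) ^ (a + b) := by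
  have hX : 0 < Fp ^ b * Fr ^ a := by positivity
  have h1 : (A * (WLp * Gp)) ^ b * (Cc * (WLr * Gr)) ^ a * (Fp ^ b * Fr ^ a)
      = (A * (WLp * Fp)) ^ b * (Cc * (WLr * Fr)) ^ a * (Gp ^ b * Gr ^ a) := by ring
  have h2 : (A * (WLp * Fp)) ^ b * (Cc * (WLr * Fr)) ^ a * (Gp ^ b * Gr ^ a)
      ≤ (B * (WLq * Fq)) ^ (a + b) * (Gp ^ b * Gr ^ a) :=
    mul_le_mul_of_nonneg_right hrow (by positivity)
  have h3 : (B * (WLq * Fq)) ^ (a + b) * (Gp ^ b * Gr ^ a) = (B * WLq) ^ (a + b) * (Fq ^ (a + b) * Gp ^ b * Gr ^ a) := by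
    ring
  have h4 : (B * WLq) ^ (a + b) * (Fq ^ (a + b) * Gp ^ b * Gr ^ a) ≤ (B * WLq) ^ (a + b) * (Gq ^ (a + b) * Fp ^ b * Fr ^ a) :=
    mul_le_mul_of_nonneg_left hmono (by positivity)
  have h5 : (B * WLq) ^ (a + b) * (Gq ^ (a + b) * Fp ^ b * Fr ^ a) = (B * (WLq * Gq)) ^ (a + b) * (Fp ^ b * Fr ^ a) := by
    ring
  have key : (A * (WLp * Gp)) ^ b * (Cc * (WLr * Gr)) ^ a * (Fp ^ b * Fr ^ a)
      ≤ (B * (WLq * Gq)) ^ (a + b) * (Fp ^ b * Fr ^ a) := by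
    rw [h1]; exact (h2.trans (h3.le.trans h4)).trans h5.le
  exact le_of_mul_le_mul_right key hX

/-- **Far-factor monotonicity for a whole cluster of far exponents** (product form of `far_factor_le` over `Fin k`):
with `κq j = κr j + b`, `κp j = κr j + b + a` (the gaps of the row) and shifts `x j ≥ 0`,
`(∏ (x+κq))^(a+b) (∏ κp)^b (∏ κr)^a ≤ (∏ κq)^(a+b) (∏ (x+κp))^b (∏ (x+κr))^a`. [folklore] -/
theorem far_product_le {k : ℕ} (x κp κq κr : Fin k → ℝ) (hx : ∀ j, 0 ≤ x j) (hκ : ∀ j, 0 < κr j) (a b : ℕ)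
    (hq : ∀ j, κq j = κr j + b) (hp : ∀ j, κp j = κr j + b + a) :
    (∏ j, (x j + κq j)) ^ (a + b) * (∏ j, κp j) ^ b * (∏ j, κr j) ^ a
      ≤ (∏ j, κq j) ^ (a + b) * (∏ j, (x j + κp j)) ^ b * (∏ j, (x j + κr j)) ^ a := by
  rw [← Finset.prod_pow, ← Finset.prod_pow, ← Finset.prod_pow, ← Finset.prod_pow, ← Finset.prod_pow,
    ← Finset.prod_pow, ← Finset.prod_mul_distrib, ← Finset.prod_mul_distrib, ← Finset.prod_mul_distrib,
    ← Finset.prod_mul_distrib]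
  refine Finset.prod_le_prod (fun j _ => ?_) (fun j _ => ?_)
  · have := hκ j
    have := hx j
    rw [hq j, hp j]
    positivity
  · rw [hq j, hp j]
    exact far_factor_le (x j) (κr j) (hx j) (hκ j) a b

/-- `row_transfer` with three independent exponents (the form produced by `newton_cone` after evaluation). [folklore] -/
theorem row_transfer' {A B Cc WLp WLq WLr Fp Fq Fr Gp Gq Gr : ℝ} {i j k : ℕ}
    (hB : 0 ≤ B) (hWLq : 0 ≤ WLq) (hFp : 0 < Fp) (hFr : 0 < Fr) (hGp : 0 ≤ Gp) (hGr : 0 ≤ Gr)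
    (hrow : (A * (WLp * Fp)) ^ i * (Cc * (WLr * Fr)) ^ j ≤ (B * (WLq * Fq)) ^ k)
    (hmono : Fq ^ k * Gp ^ i * Gr ^ j ≤ Gq ^ k * Fp ^ i * Fr ^ j) :
    (A * (WLp * Gp)) ^ i * (Cc * (WLr * Gr)) ^ j ≤ (B * (WLq * Gq)) ^ k := by
  have hX : 0 < Fp ^ i * Fr ^ j := by positivity
  have h1 : (A * (WLp * Gp)) ^ i * (Cc * (WLr * Gr)) ^ j * (Fp ^ i * Fr ^ j)
      = (A * (WLp * Fp)) ^ i * (Cc * (WLr * Fr)) ^ j * (Gp ^ i * Gr ^ j) := by ring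
  have h2 : (A * (WLp * Fp)) ^ i * (Cc * (WLr * Fr)) ^ j * (Gp ^ i * Gr ^ j)
      ≤ (B * (WLq * Fq)) ^ k * (Gp ^ i * Gr ^ j) :=
    mul_le_mul_of_nonneg_right hrow (by positivity)
  have h3 : (B * (WLq * Fq)) ^ k * (Gp ^ i * Gr ^ j) = (B * WLq) ^ k * (Fq ^ k * Gp ^ i * Gr ^ j) := by ring
  have h4 : (B * WLq) ^ k * (Fq ^ k * Gp ^ i * Gr ^ j) ≤ (B * WLq) ^ k * (Gq ^ k * Fp ^ i * Fr ^ j) :=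
    mul_le_mul_of_nonneg_left hmono (by positivity)
  have h5 : (B * WLq) ^ k * (Gq ^ k * Fp ^ i * Fr ^ j) = (B * (WLq * Gq)) ^ k * (Fp ^ i * Fr ^ j) := by ring
  have key : (A * (WLp * Gp)) ^ i * (Cc * (WLr * Gr)) ^ j * (Fp ^ i * Fr ^ j)
      ≤ (B * (WLq * Gq)) ^ k * (Fp ^ i * Fr ^ j) := by
    rw [h1]; exact (h2.trans (h3.le.trans h4)).trans h5.le
  exact le_of_mul_le_mul_right key hX

end Summit.ValiantsHypothesis.ValiantsHypothesis.Theorems.LacunarySymmetroidMatrixDescartes.Census
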